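import Literature.NumberTheory.LFunctions.TwistedVonMangoldtSum
import Literature.NumberTheory.LFunctions.VinogradovKorobovFromRichert
import HarnessLib

/-!
# The twisted prime number theorem for `Λ(n) n^{-iτ}` from a zero-free region for `ζ` ALONE

Topic `Literature/NumberTheory/LFunctions`.  Everything in this file is PROVED; there are no
definitions and no named facts.

`TwistedVonMangoldtSum.lean` proves the twisted prime number theorem at scale `X`
(`‖∑_{n ≤ x} χ(n)Λ(n)n^{-iτ} − δ_χ x^{1−iτ}/(1 − iτ)‖ ≤ (log X)^{-K} x` for `q ≤ (log X)^A`,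
`|τ| ≤ X`, `exp((log X)^θ)/2 ≤ x ≤ X`, `θ > 2/3`) for ALL Dirichlet characters, from a
Vinogradov–Korobov zero-free region for all Dirichlet `L`-functions (`HasVKZeroFreeRegion c T₀`,
e.g. Khale's theorem `Khale2024_zeroFreeRegion`, or `hasVKZeroFreeRegion_of_richert` from Richert-type
bounds for `ζ` AND for the `L(s, χ)`, `χ ≠ χ₀`).  Several consumers only ever use the PRINCIPAL
character — Matomäki–Radziwiłł 2016 (Lemma 2: "by the zero-free region for the Riemann zeta-function";
Lemma 11: "staying in the zero-free region of the `ζ`-function") being the case in point — and for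
them the `L`-function half of that hypothesis is foreign to the source.  This file re-runs the
principal-character case of the chain from the one analytic input it actually uses, zero-freeness
of `ζ₁ = (s − 1)ζ(s)` on the rectangles `|Im s| ≤ 3X`, `Re s ≥ 1 − (log X)^{-η}` for every
`η > 2/3` and all large `X`, written INLINE as the hypothesis

  `hZ : ∀ η : ℝ, 2/3 < η → ∀ᶠ X : ℝ in atTop, ∀ s : ℂ, |s.im| ≤ 3X → 1 − (log X)^{-η} ≤ s.re → ζ₁ s ≠ 0`

("scale-wise zero-freeness"; no definition is introduced for it), and supplies that hypothesis from
each zero-free region for `ζ` of Vinogradov–Korobov strength in the tree: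

* `ZetaScale.scaleZeroFree_of_zetaRegion` — from ANY region `ζ(σ + it) ≠ 0` for `|t| ≥ T₀`,
  `σ ≥ 1 − c/((log|t|)^{2/3}(log log|t|)^{1/3})` (`c > 0`; inexplicit, `ζ` only): the width
  comparison `VKDirichlet.eventually_rpow_le_vk_width` at `q = 1` and the de la Vallée-Poussin region
  for `ζ₁` (`classicalZFRData_riemannZeta`) at bounded height — the proof of
  `VKDirichlet.eventually_riemannZeta₁_ne_zero_of_vk` without the detour through `L(s, χ₀ mod 3)`;
* `ZetaScale.scaleZeroFree_of_vk` — from `HasVKZeroFreeRegion c T₀` (this IS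
  `VKDirichlet.eventually_riemannZeta₁_ne_zero_of_vk`);
* `ZetaScale.scaleZeroFree_of_ford` — from Ford's Theorem 1 alone (`zeta_bound_ford`, through the
  inexplicit region `zeta_zeroFree_of_zeta_bound_ford` of `VinogradovKorobovFromRichert.lean`,
  Titchmarsh Thm 3.10/§6.19; any other Richert-type bound for `ζ` feeds `scaleZeroFree_of_zetaRegion`
  through `VKFromRichert.zeta_zeroFree_of_richertType` in the same way);

then, with `hZ` in place of the Vinogradov–Korobov region and the character fixed to `χ₀`
(statements quantify `∀ χ, χ = 1 → …` so that the proofs are those of the originals verbatim):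

* `ZetaScale.exists_norm_logDeriv_riemannZeta₁_le_of_scale` — `ζ₁'/ζ₁(s) ≪ (log X)³` on `|Im s| ≤ 2X`,
  `1 − (log X)^{-η}/2 ≤ Re s ≤ 2` (MV Lemma 12.1; proof of `VKDirichlet.…_of_vk`);
* `ZetaScale.exists_norm_logDeriv_LFunctionTrivChar₁_le_of_scale` — the same for Mathlib's entire
  `L₁(s, χ₀ mod q) = ζ₁(s)∏_{p ∣ q}(1 − p^{-s})`, `q ≤ (log X)^A`;
* `ZetaScale.exists_twistData_one_of_scale` — the hypotheses `TwistData` of the Landau–Riesz contour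
  engine (`TwistedRieszMean`) for `b(n) = χ₀(n)Λ(n)n^{-iτ}` at scale `X`;
* `ZetaScale.twisted_sum_estimate_one_of_scale` — **the twisted prime number theorem for the principal
  character from `hZ` alone**: for `A > 0`, `θ > 2/3`, `K ≥ 0`, all large `X`, `q ≤ (log X)^A`,
  `|τ| ≤ X`, `exp((log X)^θ)/2 ≤ x ≤ X`:
  `‖∑_{n ≤ x} χ₀(n)Λ(n)n^{-iτ} − x^{1−iτ}/(1 − iτ)‖ ≤ (log X)^{-K} x`
  (the proof of `TwistedVonMangoldt.twisted_sum_estimate_of_vk`, verbatim).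

Consumers: `ZetaScaleTwistedPrimeSumTail.lean` (the prime tail of Matomäki–Radziwiłł's Lemma 2) and
the Matomäki–Radziwiłł 2016 chain (Lemma 11, Lemma 3, Proposition 1, Theorems 3 and 1), whose trust
base thereby becomes a zero-free region for `ζ` alone (e.g. `zeta_bound_ford`).

## References
* K. Matomäki, M. Radziwiłł, *Multiplicative functions in short intervals*, Ann. of Math. 183 (2016),
  Lemma 2 (proof) and Lemma 11 (proof). [cite: MatomakiRadziwillAnnals2016, Lemma 2 and Lemma 11]
* H. L. Montgomery, R. C. Vaughan, *Multiplicative Number Theory I*, CUP 2007, Theorem 6.6, Lemma 12.1,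
  §11.3 (11.22). [MontgomeryVaughan2007]
* E. C. Titchmarsh, *The Theory of the Riemann Zeta-Function*, 2nd ed., Thm 3.10 and §6.19. [Titchmarsh1986]
* K. Ford, Proc. LMS 85 (2002), Theorem 1. [Ford2002]
* J. D. Lichtman, arXiv:2009.08969, Lemma 4.5 (the shape of the twisted prime number theorem). [Lichtman2020]
-/

noncomputable section

open Complex Filter Topology Metric Set Finset
open scoped ArithmeticFunction.vonMangoldt

namespace Literature.NumberTheory.LFunctions

namespace ZetaScale

open VKDirichlet TwistedVonMangoldt

/-! ### Scale-wise zero-freeness of `ζ₁` from zero-free regions for `ζ` -/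

/-- **Scale-wise zero-freeness from any Vinogradov–Korobov region for `ζ` alone.**  Assume `c > 0` and
`ζ(s) ≠ 0` for `|Im s| ≥ T₀`, `Re s ≥ 1 − c/((log|Im s|)^{2/3}(log log|Im s|)^{1/3})`.  Then for every
`η > 2/3` and all large `X`: `ζ₁(s) ≠ 0` for `|Im s| ≤ 3X`, `Re s ≥ 1 − (log X)^{-η}`.  Heights
`|t| ≥ max T₀ 10`: the region, its width exceeding `(log X)^{-η}` (`eventually_rpow_le_vk_width` at
`q = 1`); heights `|t| < max T₀ 10`: the de la Vallée-Poussin region for `ζ₁` (`classicalZFRData_riemannZeta`,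
MV Thm 6.6), whose width at bounded height exceeds `(log X)^{-η}` too.
[cite: MontgomeryVaughan2007, Theorem 6.6] [cite: Titchmarsh1986, §6.19] -/
theorem scaleZeroFree_of_zetaRegion {c T₀ : ℝ} (hc : 0 < c)
    (hR : ∀ s : ℂ, T₀ ≤ |s.im| →
      1 - c / (Real.log |s.im| ^ (2 / 3 : ℝ) * Real.log (Real.log |s.im|) ^ (1 / 3 : ℝ)) ≤ s.re →
        riemannZeta s ≠ 0) :
    ∀ η : ℝ, 2 / 3 < η → ∀ᶠ X : ℝ in atTop, ∀ s : ℂ, |s.im| ≤ 3 * X →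
      1 - Real.log X ^ (-η) ≤ s.re → riemannZeta₁ s ≠ 0 := by
  intro η hη
  obtain ⟨c₀, hc₀, hzf⟩ := classicalZFRData_riemannZeta.zeroFree
  have hη0 : 0 < η := by linarith
  have hT : (0 : ℝ) ≤ max T₀ 10 := le_max_of_le_right (by norm_num)
  filter_upwards [eventually_rpow_le_vk_width one_pos hη hc,
    eventually_rpow_lt_classical_width_of_le one_pos hη0 hc₀ hT,
    eventually_rpow_neg_lt hη0 (show (0 : ℝ) < 1 / 2 by norm_num),
    Real.tendsto_log_atTop.eventually_ge_atTop (3 : ℝ)] with X h1 h2 hhalf hL3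
  intro s hsX hre hzero
  have h1A : ((1 : ℕ) : ℝ) ≤ Real.log X ^ (1 : ℝ) := by rw [Real.rpow_one, Nat.cast_one]; linarith
  rcases le_or_gt (max T₀ 10) |s.im| with h10 | h10
  · have h10' : 10 ≤ |s.im| := (le_max_right _ _).trans h10
    have hs1 : s ≠ 1 := by
      rintro rfl
      have : |(1 : ℂ).im| = 0 := by simp
      linarith
    have hζ : riemannZeta s = 0 := (riemannZeta₁_eq_zero_iff hs1).1 hzero
    have hw := h1 1 le_rfl h1A s.im h10' hsX
    rw [Nat.cast_one, Real.log_one, zero_add] at hw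
    exact hR s ((le_max_left _ _).trans h10) (by linarith) hζ
  · have hlt := h2 1 le_rfl h1A s.im h10.le
    rw [Nat.cast_one, Real.log_one, zero_add] at hlt
    refine hzf s ?_ (by linarith) hzero
    linarith

/-- Scale-wise zero-freeness of `ζ₁` from a Vinogradov–Korobov region for all Dirichlet `L`-functions
(`HasVKZeroFreeRegion c T₀`, `c > 0`): this is `VKDirichlet.eventually_riemannZeta₁_ne_zero_of_vk`.
[cite: Khale2024, (1.4)] -/
theorem scaleZeroFree_of_vk {c T₀ : ℝ} (hc : 0 < c) (hVK : HasVKZeroFreeRegion c T₀) :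
    ∀ η : ℝ, 2 / 3 < η → ∀ᶠ X : ℝ in atTop, ∀ s : ℂ, |s.im| ≤ 3 * X →
      1 - Real.log X ^ (-η) ≤ s.re → riemannZeta₁ s ≠ 0 :=
  fun _ hη => eventually_riemannZeta₁_ne_zero_of_vk hc hVK hη

/-- Scale-wise zero-freeness of `ζ₁` from Ford's Theorem 1 alone (`zeta_bound_ford`:
`|ζ(σ + it)| ≤ 76.2 t^{4.45(1−σ)^{3/2}}(log t)^{2/3}`). [cite: Ford2002, Theorem 1] -/
theorem scaleZeroFree_of_ford (h : zeta_bound_ford) :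
    ∀ η : ℝ, 2 / 3 < η → ∀ᶠ X : ℝ in atTop, ∀ s : ℂ, |s.im| ≤ 3 * X →
      1 - Real.log X ^ (-η) ≤ s.re → riemannZeta₁ s ≠ 0 := by
  obtain ⟨c, hc, hR⟩ := zeta_zeroFree_of_zeta_bound_ford h
  exact scaleZeroFree_of_zetaRegion hc hR

/-! ### Logarithmic derivatives in the half-width rectangle -/

/-- **`ζ₁'/ζ₁(s) ≪ (log X)³` in the half-width rectangle** `|Im s| ≤ 2X`,
`1 − (log X)^{-η}/2 ≤ Re s ≤ 2` (`2/3 < η ≤ 1`), from scale-wise zero-freeness of `ζ₁` alone: MV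
Lemma 12.1 in the tree's disc form (`exists_norm_logDeriv_riemannZeta₁_sub_sum_le`), the Jensen count
`exists_sum_zetaDiscZeros_le`, and the distance `≥ (log X)^{-η}/2` of `s` from every zero (the proof of
`VKDirichlet.exists_norm_logDeriv_riemannZeta₁_le_of_vk`, verbatim).
[cite: MontgomeryVaughan2007, Lemma 12.1] -/
theorem exists_norm_logDeriv_riemannZeta₁_le_of_scale
    (hZ : ∀ η : ℝ, 2 / 3 < η → ∀ᶠ X : ℝ in atTop, ∀ s : ℂ, |s.im| ≤ 3 * X →
      1 - Real.log X ^ (-η) ≤ s.re → riemannZeta₁ s ≠ 0)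
    {η : ℝ} (hη : 2 / 3 < η) (hη1 : η ≤ 1) :
    ∃ C : ℝ, 0 ≤ C ∧ ∀ᶠ X : ℝ in atTop, ∀ s : ℂ, |s.im| ≤ 2 * X →
      1 - Real.log X ^ (-η) / 2 ≤ s.re → s.re ≤ 2 →
        riemannZeta₁ s ≠ 0 ∧ ‖deriv riemannZeta₁ s / riemannZeta₁ s‖ ≤ C * Real.log X ^ 3 := by
  obtain ⟨C₁, hC₁, hdisc⟩ := exists_norm_logDeriv_riemannZeta₁_sub_sum_le
  obtain ⟨C₂, hC₂, hcount⟩ := exists_sum_zetaDiscZeros_le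
  have hη0 : 0 < η := by linarith
  refine ⟨3 * C₁ + 6 * C₂, by positivity, ?_⟩
  filter_upwards [hZ η hη,
    eventually_rpow_neg_lt hη0 (show (0 : ℝ) < 1 by norm_num), eventually_ge_atTop (4 : ℝ),
    Real.tendsto_log_atTop.eventually_ge_atTop (1 : ℝ)] with X hzf hsmall hX4 hL1
  intro s hsX hre hre2
  set L : ℝ := Real.log X with hLdef
  have hL0 : 0 < L := by linarith
  set δ : ℝ := L ^ (-η) with hδdef
  have hδpos : 0 < δ := Real.rpow_pos_of_pos hL0 _
  have hζs : riemannZeta₁ s ≠ 0 := hzf s (by linarith) (by linarith)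
  refine ⟨hζs, ?_⟩
  have hsc : s - (2 + s.im * I) = ((s.re - 2 : ℝ) : ℂ) := Complex.ext (by simp) (by simp)
  have hball : s ∈ closedBall (2 + (s.im : ℂ) * I) (7 / 4) := by
    rw [mem_closedBall, dist_eq_norm, hsc, Complex.norm_real, Real.norm_eq_abs, abs_le]
    constructor <;> linarith
  have h := hdisc s.im s hball hζs
  have hlog : Real.log (|s.im| + 4) ≤ 3 * L := by
    have h1A : ((1 : ℕ) : ℝ) ≤ Real.log X ^ (1 : ℝ) := by
      rw [Real.rpow_one, Nat.cast_one]; exact hL1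
    have := ell_le_of_scale one_pos hX4 hL1 le_rfl h1A hsX
    rw [Nat.cast_one, Real.log_one, zero_add] at this
    linarith
  have hdist : ∀ ρ ∈ zetaDiscZeros s.im, δ / 2 ≤ ‖s - ρ‖ := by
    intro ρ hρ
    obtain ⟨hρball, hρzero⟩ := mem_zetaDiscZeros.1 hρ
    have him : |ρ.im - s.im| ≤ 37 / 20 := by
      rw [mem_closedBall, dist_eq_norm] at hρball
      calc |ρ.im - s.im| = |(ρ - (2 + (s.im : ℂ) * I)).im| := by simp
        _ ≤ ‖ρ - (2 + (s.im : ℂ) * I)‖ := Complex.abs_im_le_norm _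
        _ ≤ 37 / 20 := hρball
    have hρim : |ρ.im| ≤ 3 * X := by
      have := abs_sub_abs_le_abs_sub ρ.im s.im
      linarith
    have hρre : ρ.re < 1 - δ := by
      by_contra h'
      exact hzf ρ hρim (not_lt.1 h') hρzero
    calc δ / 2 ≤ s.re - ρ.re := by linarith
      _ = (s - ρ).re := by simp
      _ ≤ ‖s - ρ‖ := Complex.re_le_norm _
  have h1 : ‖∑ ρ ∈ zetaDiscZeros s.im, (zetaDiscDivisor s.im ρ : ℂ) / (s - ρ)‖ ≤
      2 / δ * ∑ ρ ∈ zetaDiscZeros s.im, (zetaDiscDivisor s.im ρ : ℝ) := by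
    calc ‖∑ ρ ∈ zetaDiscZeros s.im, (zetaDiscDivisor s.im ρ : ℂ) / (s - ρ)‖
        ≤ ∑ ρ ∈ zetaDiscZeros s.im, ‖(zetaDiscDivisor s.im ρ : ℂ) / (s - ρ)‖ := norm_sum_le _ _
      _ ≤ ∑ ρ ∈ zetaDiscZeros s.im, (zetaDiscDivisor s.im ρ : ℝ) * (2 / δ) :=
          Finset.sum_le_sum fun ρ hρ ↦ by
            have h0 : (0 : ℝ) ≤ (zetaDiscDivisor s.im ρ : ℝ) := by
              exact_mod_cast zetaDiscDivisor_nonneg s.im ρ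
            have := norm_div_le_of_le_norm h0 hδpos (hdist ρ hρ)
            simpa using this
      _ = 2 / δ * ∑ ρ ∈ zetaDiscZeros s.im, (zetaDiscDivisor s.im ρ : ℝ) := by
          rw [← Finset.sum_mul, mul_comm]
  have h2 : ‖deriv riemannZeta₁ s / riemannZeta₁ s‖ ≤ C₁ * (3 * L) + 2 / δ * (C₂ * (3 * L)) := by
    have heq : deriv riemannZeta₁ s / riemannZeta₁ s =
        (logDeriv riemannZeta₁ s -
          ∑ ρ ∈ zetaDiscZeros s.im, (zetaDiscDivisor s.im ρ : ℂ) / (s - ρ)) +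
          ∑ ρ ∈ zetaDiscZeros s.im, (zetaDiscDivisor s.im ρ : ℂ) / (s - ρ) := by
      rw [logDeriv_apply]; ring
    rw [heq]
    refine (norm_add_le _ _).trans (add_le_add ?_ ?_)
    · exact h.trans (mul_le_mul_of_nonneg_left hlog hC₁.le)
    · refine h1.trans (mul_le_mul_of_nonneg_left ?_ (by positivity))
      exact (hcount s.im).trans (mul_le_mul_of_nonneg_left hlog hC₂.le)
  have h3 : 2 / δ ≤ 2 * L := by
    rw [hδdef, Real.rpow_neg hL0.le, div_inv_eq_mul]
    refine mul_le_mul_of_nonneg_left ?_ (by norm_num)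
    calc L ^ η ≤ L ^ (1 : ℝ) := Real.rpow_le_rpow_of_exponent_le hL1 hη1
      _ = L := Real.rpow_one L
  have hL3 : L ≤ L ^ 3 := by
    calc L = L ^ 1 := (pow_one L).symm
      _ ≤ L ^ 3 := pow_le_pow_right₀ hL1 (by norm_num)
  have hL23 : L ^ 2 ≤ L ^ 3 := pow_le_pow_right₀ hL1 (by norm_num)
  calc ‖deriv riemannZeta₁ s / riemannZeta₁ s‖ ≤ C₁ * (3 * L) + 2 / δ * (C₂ * (3 * L)) := h2
    _ ≤ C₁ * (3 * L) + 2 * L * (C₂ * (3 * L)) := by gcongr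
    _ = 3 * C₁ * L + 6 * C₂ * L ^ 2 := by ring
    _ ≤ 3 * C₁ * L ^ 3 + 6 * C₂ * L ^ 3 := by gcongr
    _ = (3 * C₁ + 6 * C₂) * L ^ 3 := by ring

/-- **The principal character: `L₁'/L₁(s, χ₀) ≪_A (log X)³`** in the half-width rectangle, for
Mathlib's entire `L₁(s, χ₀) = (s − 1)L(s, χ₀)` (`DirichletCharacter.LFunctionTrivChar₁ q`), equal to
`ζ₁(s) ∏_{p ∣ q}(1 − p^{-s})`, so that `‖L₁'/L₁‖ ≤ ‖ζ₁'/ζ₁‖ + 3 log q`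
(`SiegelWalfisz.norm_logDeriv_LFunctionTrivChar₁_le`) and `L₁ ≠ 0` there; `q ≤ (log X)^A`; from
scale-wise zero-freeness of `ζ₁` alone (the proof of
`VKDirichlet.exists_norm_logDeriv_LFunctionTrivChar₁_le_of_vk`, verbatim).
[cite: MontgomeryVaughan2007, Lemma 11.1 (proof, (4.22))] -/
theorem exists_norm_logDeriv_LFunctionTrivChar₁_le_of_scale
    (hZ : ∀ η : ℝ, 2 / 3 < η → ∀ᶠ X : ℝ in atTop, ∀ s : ℂ, |s.im| ≤ 3 * X →
      1 - Real.log X ^ (-η) ≤ s.re → riemannZeta₁ s ≠ 0)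
    {A η : ℝ} (hA : 0 < A) (hη : 2 / 3 < η) (hη1 : η ≤ 1) :
    ∃ C : ℝ, 0 ≤ C ∧ ∀ᶠ X : ℝ in atTop, ∀ (q : ℕ) [NeZero q], (q : ℝ) ≤ Real.log X ^ A →
      ∀ s : ℂ, |s.im| ≤ 2 * X → 1 - Real.log X ^ (-η) / 2 ≤ s.re → s.re ≤ 2 →
        DirichletCharacter.LFunctionTrivChar₁ q s ≠ 0 ∧
          ‖deriv (DirichletCharacter.LFunctionTrivChar₁ q) s /
              DirichletCharacter.LFunctionTrivChar₁ q s‖ ≤ C * Real.log X ^ 3 := by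
  obtain ⟨C, hC, hζ⟩ := exists_norm_logDeriv_riemannZeta₁_le_of_scale hZ hη hη1
  have hη0 : 0 < η := by linarith
  refine ⟨C + 3 * A, by positivity, ?_⟩
  filter_upwards [hζ, eventually_rpow_neg_lt hη0 (show (0 : ℝ) < 1 / 2 by norm_num),
    eventually_ge_atTop (4 : ℝ), Real.tendsto_log_atTop.eventually_ge_atTop (1 : ℝ)]
    with X hζX hsmall hX4 hL1
  intro q _ hqA s hsX hre hre2
  have hq1 : 1 ≤ q := Nat.one_le_iff_ne_zero.2 (NeZero.ne q)
  set L : ℝ := Real.log X with hLdef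
  have hL0 : 0 < L := by linarith
  obtain ⟨hζs, hb⟩ := hζX s hsX hre hre2
  obtain ⟨hne, hle⟩ := SiegelWalfisz.norm_logDeriv_LFunctionTrivChar₁_le q (s := s) (by linarith) hζs
  refine ⟨hne, hle.trans ?_⟩
  have hlogq : Real.log q ≤ A * L := by
    have h := log_le_of_le_rpow hL0 hq1 hqA
    have h2 : Real.log L ≤ L := by have := Real.log_le_sub_one_of_pos hL0; linarith
    exact h.trans (mul_le_mul_of_nonneg_left h2 hA.le)
  have hL3 : L ≤ L ^ 3 := by
    calc L = L ^ 1 := (pow_one L).symm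
      _ ≤ L ^ 3 := pow_le_pow_right₀ hL1 (by norm_num)
  calc ‖deriv riemannZeta₁ s / riemannZeta₁ s‖ + 3 * Real.log q ≤ C * L ^ 3 + 3 * (A * L) := by
        gcongr
    _ ≤ C * L ^ 3 + 3 * A * L ^ 3 := by
        have : 3 * (A * L) ≤ 3 * A * L ^ 3 := by
          rw [mul_assoc]; exact mul_le_mul_of_nonneg_left (mul_le_mul_of_nonneg_left hL3 hA.le)
            (by norm_num)
        linarith
    _ = (C + 3 * A) * L ^ 3 := by ring

/-! ### `TwistData` and the twisted prime number theorem for the principal character -/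

/-- **`TwistData` at scale `X` for the principal character, from scale-wise zero-freeness of `ζ₁`.**
For `A > 0`, `2/3 < η ≤ 1` there is `C ≥ 0` such that for all large `X`, all `q ≤ (log X)^A`, the
principal character `χ₀` mod `q`, all `|τ| ≤ X` and `1 ≤ T ≤ X`:
`TwistData (twist χ₀ τ) (G χ₀ τ) 1 (1 − iτ) (1 − (log X)^{-η}/2) T (C (log X)³)` — the principal case of
`TwistedVonMangoldt.exists_twistData_of_vk`, with `exists_norm_logDeriv_LFunctionTrivChar₁_le_of_scale`.
[cite: MontgomeryVaughan2007, §11.3 (11.22)] -/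
theorem exists_twistData_one_of_scale
    (hZ : ∀ η : ℝ, 2 / 3 < η → ∀ᶠ X : ℝ in atTop, ∀ s : ℂ, |s.im| ≤ 3 * X →
      1 - Real.log X ^ (-η) ≤ s.re → riemannZeta₁ s ≠ 0)
    {A η : ℝ} (hA : 0 < A) (hη : 2 / 3 < η) (hη1 : η ≤ 1) :
    ∃ C : ℝ, 0 ≤ C ∧ ∀ᶠ X : ℝ in atTop, ∀ (q : ℕ) [NeZero q], (q : ℝ) ≤ Real.log X ^ A →
      ∀ (χ : DirichletCharacter ℂ q), χ = 1 → ∀ (τ : ℝ), |τ| ≤ X → ∀ T : ℝ, 1 ≤ T → T ≤ X →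
        TwistedRieszMean.TwistData (twist χ τ) (G χ τ) (delta χ) (1 - τ * I)
          (1 - Real.log X ^ (-η) / 2) T (C * Real.log X ^ 3) := by
  obtain ⟨C₂, hC₂, h₂⟩ := exists_norm_logDeriv_LFunctionTrivChar₁_le_of_scale hZ hA hη hη1
  have hη0 : 0 < η := by linarith
  refine ⟨C₂, hC₂, ?_⟩
  filter_upwards [h₂, eventually_rpow_neg_lt hη0 one_pos,
    Real.tendsto_log_atTop.eventually_ge_atTop (1 : ℝ)] with X h₂X hsmall hL1
  intro q _ hqA χ hχ τ hτ T hT1 hTX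
  subst hχ
  set ℓ : ℝ := Real.log X with hℓ
  have hℓ0 : 0 ≤ ℓ := by linarith
  have hδpos : 0 < ℓ ^ (-η) := Real.rpow_pos_of_pos (by linarith) _
  -- points of the shifted rectangle
  have hrect : ∀ s ∈ Icc (1 - ℓ ^ (-η) / 2) 2 ×ℂ Icc (-T) T,
      |(s + τ * I).im| ≤ 2 * X ∧ 1 - ℓ ^ (-η) / 2 ≤ (s + τ * I).re ∧ (s + τ * I).re ≤ 2 := by
    intro s hs
    obtain ⟨⟨hre1, hre2⟩, him1, him2⟩ := hs
    refine ⟨?_, by simpa using hre1, by simpa using hre2⟩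
    have him : (s + τ * I).im = s.im + τ := by simp
    rw [him]
    have h1 : |s.im| ≤ T := abs_le.2 ⟨him1, him2⟩
    calc |s.im + τ| ≤ |s.im| + |τ| := abs_add_le _ _
      _ ≤ T + X := add_le_add h1 hτ
      _ ≤ 2 * X := by linarith
  refine ⟨norm_twist_le 1 τ, norm_delta_le 1, by simp, by linarith, by linarith, hT1,
    by positivity, fun s hs ↦ LSeries_twist_eq 1 τ hs, ?_, ?_⟩
  · intro s hs
    obtain ⟨him, hre1, hre2⟩ := hrect s hs
    obtain ⟨hne, -⟩ := h₂X q hqA (s + τ * I) him hre1 hre2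
    rw [G_one]
    exact (differentiableAt_neg_logDeriv_shift
      (DirichletCharacter.differentiable_LFunctionTrivChar₁ q) (τ * I) hne).differentiableWithinAt
  · intro s hs
    obtain ⟨him, hre1, hre2⟩ := hrect s hs
    obtain ⟨-, hle⟩ := h₂X q hqA (s + τ * I) him hre1 hre2
    rw [G_one]
    simp only [norm_neg]
    exact hle

set_option maxHeartbeats 1600000 in
/-- **The twisted prime number theorem at scale `X` for the principal character, from scale-wise
zero-freeness of `ζ₁` alone.**  For `A > 0`, `θ > 2/3`, `K ≥ 0`: for all large `X`, all `q ≤ (log X)^A`,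
the principal character `χ₀` mod `q`, all real `τ` with `|τ| ≤ X` and all `x` with
`exp((log X)^θ)/2 ≤ x ≤ X`,
`‖∑_{n ≤ x} χ₀(n)Λ(n)n^{-iτ} − x^{1−iτ}/(1 − iτ)‖ ≤ (log X)^{-K} x`.
Proof: that of `TwistedVonMangoldt.twisted_sum_estimate_of_vk` verbatim (`TwistData` from
`exists_twistData_one_of_scale` with `2/3 < η < θ`, `T = 160 D₀ (log X)^{2K} ≤ X`, the contour estimate
and the differencing step of `TwistedRieszMean` with `y = x(1 + ε/4)`, `ε = (log X)^{-K}`, the saving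
`x^{−(log X)^{-η}/2} ≤ e^{1/2 − (log X)^{θ−η}/2}` and de la Vallée-Poussin's
`ψ(y) − ψ(x) ≤ (y − x) + 3C₁x e^{−c₁√log x}`).
[cite: MatomakiRadziwillAnnals2016, Lemma 11 (proof)] [cite: Lichtman2020, Lemma 4.5] -/
theorem twisted_sum_estimate_one_of_scale
    (hZ : ∀ η : ℝ, 2 / 3 < η → ∀ᶠ X : ℝ in atTop, ∀ s : ℂ, |s.im| ≤ 3 * X →
      1 - Real.log X ^ (-η) ≤ s.re → riemannZeta₁ s ≠ 0)
    {A θ K : ℝ} (hA : 0 < A) (hθ : 2 / 3 < θ) (hK0 : 0 ≤ K) :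
    ∀ᶠ X : ℝ in atTop, ∀ (q : ℕ) [NeZero q], (q : ℝ) ≤ Real.log X ^ A →
      ∀ (χ : DirichletCharacter ℂ q), χ = 1 → ∀ (τ : ℝ), |τ| ≤ X → ∀ x : ℝ,
        Real.exp (Real.log X ^ θ) / 2 ≤ x → x ≤ X →
          ‖∑ n ∈ Finset.Ioc 0 ⌊x⌋₊, twist χ τ n -
              delta χ * (x : ℂ) ^ (1 - τ * I) / (1 - τ * I)‖ ≤ Real.log X ^ (-K) * x := by
  -- parameters
  set η : ℝ := min ((2 / 3 + θ) / 2) 1 with hηdef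
  have hη : 2 / 3 < η := lt_min (by linarith) (by norm_num)
  have hη1 : η ≤ 1 := min_le_right _ _
  have hηθ : η < θ := lt_of_le_of_lt (min_le_left _ _) (by linarith)
  have hη0 : 0 < η := by linarith
  have hθ0 : 0 < θ := by linarith
  have hθη : 0 < θ - η := by linarith
  obtain ⟨C, hC, hTD⟩ := exists_twistData_one_of_scale hZ hA hη hη1
  obtain ⟨K₀, hK₀, hKL⟩ := TwistedRieszMean.exists_norm_LSeries_le
  obtain ⟨c₁, hc₁, C₁, hψ⟩ := ChebyshevPsiDeLaValleePoussin_holds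
  set C₁' : ℝ := max C₁ 0 with hC₁'
  have hC₁'0 : 0 ≤ C₁' := le_max_right _ _
  have hψ' : ∀ u : ℝ, 2 ≤ u →
      |Chebyshev.psi u - u| ≤ C₁' * u / Real.exp (c₁ * Real.sqrt (Real.log u)) := by
    intro u hu
    refine (hψ u hu).trans ?_
    rw [mul_div_assoc, mul_div_assoc]
    exact mul_le_mul_of_nonneg_right (le_max_left _ _) (by positivity)
  set D : ℝ := 5 + K₀ + C with hDdef
  have hsqrt2 : 0 < c₁ / Real.sqrt 2 := by positivity
  filter_upwards [hTD, Real.tendsto_log_atTop.eventually_ge_atTop (1 : ℝ),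
    ((tendsto_rpow_atTop hθ0).comp Real.tendsto_log_atTop).eventually_ge_atTop (4 : ℝ),
    eventually_mul_log_rpow_le_exp (160 * D) (3 + 2 * K) one_pos one_pos,
    eventually_mul_log_rpow_le_exp (320 * C * Real.exp (1 / 2)) (3 + 2 * K)
      (show (0 : ℝ) < 1 / 2 by norm_num) hθη,
    eventually_mul_log_rpow_le_exp 16 K one_pos hθ0,
    eventually_mul_log_rpow_le_exp (24 * C₁') K hsqrt2 (half_pos hθ0),
    eventually_gt_atTop (0 : ℝ)] with X hTDX hℓ1 hℓθ hE3 hE4 hE5 hE6 hX0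
  intro q _ hqA χ hχ τ hτ x hxlo hxX
  -- notation
  set ℓ : ℝ := Real.log X with hℓdef
  have hℓ0 : 0 < ℓ := by linarith
  have hℓθ' : (4 : ℝ) ≤ ℓ ^ θ := by simpa using hℓθ
  have hexpℓ : Real.exp ℓ = X := by rw [hℓdef, Real.exp_log hX0]
  set ε : ℝ := ℓ ^ (-K) with hεdef
  have hε0 : 0 < ε := Real.rpow_pos_of_pos hℓ0 _
  have hε1 : ε ≤ 1 := Real.rpow_le_one_of_one_le_of_nonpos hℓ1 (by linarith)
  have hℓKε : ℓ ^ K * ε = 1 := by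
    rw [hεdef, ← Real.rpow_add hℓ0, show K + -K = 0 by ring, Real.rpow_zero]
  set E2 : ℝ := ℓ ^ (2 * K) with hE2def
  have hE2pos : 0 < E2 := Real.rpow_pos_of_pos hℓ0 _
  have hE21 : 1 ≤ E2 := Real.one_le_rpow hℓ1 (by positivity)
  have hεE : ε ^ 2 * E2 = 1 := by
    rw [hεdef, hE2def, ← Real.rpow_natCast, ← Real.rpow_mul hℓ0.le, ← Real.rpow_add hℓ0,
      show -K * ((2 : ℕ) : ℝ) + 2 * K = 0 by push_cast; ring, Real.rpow_zero]
  have hε2 : ε ^ 2 = 1 / E2 := by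
    rw [eq_div_iff hE2pos.ne']; exact hεE
  set B : ℝ := C * ℓ ^ 3 with hBdef
  have hB0 : 0 ≤ B := by positivity
  have hlog2X : 0 ≤ Real.log (2 * X) := Real.log_nonneg (by
    have h1 : Real.exp 1 ≤ X := by rw [← hexpℓ]; exact Real.exp_le_exp.2 hℓ1
    have h2 := Real.add_one_le_exp (1 : ℝ); linarith)
  set D₀ : ℝ := 2 * Real.log (2 * X) + K₀ + 1 + B with hD₀def
  have hD₀1 : 1 ≤ D₀ := by rw [hD₀def]; linarith
  have hD₀B : B ≤ D₀ := by rw [hD₀def]; linarith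
  set T : ℝ := 160 * D₀ * E2 with hTdef
  have hDE : 1 ≤ D₀ * E2 := by
    have := mul_le_mul hD₀1 hE21 zero_le_one (by linarith); simpa using this
  have hT1 : 1 ≤ T := by rw [hTdef]; linarith
  have hT2 : 2 ≤ T := by rw [hTdef]; linarith
  have hT0 : 0 < T := by linarith
  -- `T ≤ X`
  have hℓ3 : ℓ ^ (3 : ℕ) * E2 = ℓ ^ (3 + 2 * K) := by
    rw [← Real.rpow_natCast, hE2def, ← Real.rpow_add hℓ0]; norm_num
  have hD₀le : D₀ ≤ D * ℓ ^ (3 : ℕ) := D0_le hX0 hℓ1 hK₀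
  have hTX : T ≤ X := by
    calc T = 160 * D₀ * E2 := rfl
      _ ≤ 160 * (D * ℓ ^ (3 : ℕ)) * E2 := by gcongr
      _ = 160 * D * ℓ ^ (3 + 2 * K) := by rw [← hℓ3]; ring
      _ ≤ Real.exp (1 * ℓ ^ (1 : ℝ)) := hE3
      _ = X := by rw [one_mul, Real.rpow_one, hexpℓ]
  -- the data
  have hD := hTDX q hqA χ hχ τ hτ T hT1 hTX
  -- `x` and `y`
  have hlog2 : Real.log 2 ≤ 1 := by
    have := Real.log_le_sub_one_of_pos (show (0 : ℝ) < 2 by norm_num); linarith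
  have hx2e : Real.exp 2 ≤ x := by
    refine le_trans ?_ hxlo
    rw [le_div_iff₀ (by norm_num : (0 : ℝ) < 2)]
    calc Real.exp 2 * 2 ≤ Real.exp 2 * Real.exp 2 := by
          gcongr; have := Real.add_one_le_exp (2 : ℝ); linarith
      _ = Real.exp 4 := by rw [← Real.exp_add]; norm_num
      _ ≤ Real.exp (ℓ ^ θ) := Real.exp_le_exp.2 hℓθ'
  have hx2 : 2 ≤ x := le_trans (by have := Real.add_one_le_exp (2 : ℝ); linarith) hx2e
  have hx1 : 1 ≤ x := by linarith
  have hx0 : 0 < x := by linarith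
  have hlogx : ℓ ^ θ - Real.log 2 ≤ Real.log x := by
    have h1 : Real.log (Real.exp (ℓ ^ θ) / 2) = ℓ ^ θ - Real.log 2 := by
      rw [Real.log_div (Real.exp_pos _).ne' (by norm_num), Real.log_exp]
    rw [← h1]
    exact Real.log_le_log (by positivity) hxlo
  have hlogx' : ℓ ^ θ / 2 ≤ Real.log x := by linarith
  set Δ : ℝ := ε / 4 with hΔdef
  have hΔ0 : 0 < Δ := by positivity
  have hΔ1 : Δ ≤ 1 := by linarith
  set y : ℝ := x * (1 + Δ) with hydef
  have hyx : y - x = Δ * x := by rw [hydef]; ring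
  have hΔx : 0 < Δ * x := mul_pos hΔ0 hx0
  have hxy : x < y := by linarith
  have hΔx1 : Δ * x ≤ 1 * x := mul_le_mul_of_nonneg_right hΔ1 hx0.le
  have hy2x : y ≤ 2 * x := by linarith
  have hy2X : y ≤ 2 * X := by linarith
  have hye : Real.exp 2 ≤ y := by linarith
  have hy0 : 0 < y := by linarith
  -- the three analytic estimates
  have hIx := hD.norm_rieszMean_sub_le hK₀ hKL hx2e
  have hIy := hD.norm_rieszMean_sub_le hK₀ hKL hye
  have hmain := hD.norm_sum_sub_le hx1 hxy
  -- the saving `P = x^{σ₁ - 1}`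
  set P : ℝ := x ^ (1 - ℓ ^ (-η) / 2 - 1) with hPdef
  have hP0 : 0 < P := Real.rpow_pos_of_pos hx0 _
  have hδ1 : ℓ ^ (-η) ≤ 1 := Real.rpow_le_one_of_one_le_of_nonpos hℓ1 (by linarith)
  have hδ0 : 0 < ℓ ^ (-η) := Real.rpow_pos_of_pos hℓ0 _
  have hPle : P ≤ Real.exp (-(ℓ ^ (θ - η) / 2) + 1 / 2) := by
    rw [hPdef, Real.rpow_def_of_pos hx0]
    apply Real.exp_le_exp.2
    have h1 : Real.log x * (1 - ℓ ^ (-η) / 2 - 1) = -(ℓ ^ (-η) / 2 * Real.log x) := by ring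
    rw [h1]
    have h2 : ℓ ^ (-η) / 2 * (ℓ ^ θ - Real.log 2) ≤ ℓ ^ (-η) / 2 * Real.log x :=
      mul_le_mul_of_nonneg_left hlogx (by positivity)
    have h3 : ℓ ^ (-η) * ℓ ^ θ = ℓ ^ (θ - η) := by
      rw [← Real.rpow_add hℓ0]; ring_nf
    have h4 : ℓ ^ (-η) * Real.log 2 ≤ 1 := by
      calc ℓ ^ (-η) * Real.log 2 ≤ 1 * 1 :=
            mul_le_mul hδ1 hlog2 (Real.log_nonneg (by norm_num)) zero_le_one
        _ = 1 := one_mul _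
    have h5 : ℓ ^ (-η) / 2 * (ℓ ^ θ - Real.log 2) = ℓ ^ (θ - η) / 2 - ℓ ^ (-η) * Real.log 2 / 2 := by
      rw [← h3]; ring
    linarith
  -- (E4): `320 B P ≤ ε²`
  have hBP : 320 * B * P ≤ ε ^ 2 := by
    have h1 : 320 * B * P * E2 ≤ 1 := by
      calc 320 * B * P * E2 ≤ 320 * B * Real.exp (-(ℓ ^ (θ - η) / 2) + 1 / 2) * E2 := by
            gcongr
        _ = 320 * C * Real.exp (1 / 2) * ℓ ^ (3 + 2 * K) * Real.exp (-(ℓ ^ (θ - η) / 2)) := by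
            rw [Real.exp_add, hBdef, ← hℓ3]; ring
        _ ≤ Real.exp (1 / 2 * ℓ ^ (θ - η)) * Real.exp (-(ℓ ^ (θ - η) / 2)) :=
            mul_le_mul_of_nonneg_right hE4 (Real.exp_pos _).le
        _ = 1 := by rw [← Real.exp_add, show 1 / 2 * ℓ ^ (θ - η) + -(ℓ ^ (θ - η) / 2) = 0 by ring,
            Real.exp_zero]
    rw [hε2, le_div_iff₀ hE2pos]; exact h1
  -- (E5): `1 ≤ ε x / 8`
  have hone : 1 ≤ ε * x / 8 := by
    have h1 : 16 * ℓ ^ K ≤ Real.exp (ℓ ^ θ) := by simpa using hE5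
    have h3 : Real.exp (ℓ ^ θ) ≤ 2 * x := by linarith
    have h4 := mul_le_mul_of_nonneg_right (h1.trans h3) hε0.le
    have h5 : 16 * ℓ ^ K * ε = 16 := by rw [mul_assoc, hℓKε, mul_one]
    rw [h5] at h4
    linarith
  -- (E6): `3 C₁' x / exp(c₁ √log x) ≤ ε x / 8`
  set eψ : ℝ := Real.exp (c₁ * Real.sqrt (Real.log x)) with heψ
  have heψ0 : 0 < eψ := Real.exp_pos _
  have hψerr : 3 * C₁' * x / eψ ≤ ε * x / 8 := by
    have h1 : 24 * C₁' * ℓ ^ K ≤ Real.exp (c₁ / Real.sqrt 2 * ℓ ^ (θ / 2)) := hE6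
    have h2 : c₁ / Real.sqrt 2 * ℓ ^ (θ / 2) ≤ c₁ * Real.sqrt (Real.log x) := by
      have h3 : Real.sqrt (ℓ ^ θ / 2) ≤ Real.sqrt (Real.log x) := Real.sqrt_le_sqrt hlogx'
      have h4 : Real.sqrt (ℓ ^ θ / 2) = ℓ ^ (θ / 2) / Real.sqrt 2 := by
        rw [Real.sqrt_div (Real.rpow_nonneg hℓ0.le _), Real.sqrt_eq_rpow, ← Real.rpow_mul hℓ0.le]
        ring_nf
      rw [h4] at h3
      calc c₁ / Real.sqrt 2 * ℓ ^ (θ / 2) = c₁ * (ℓ ^ (θ / 2) / Real.sqrt 2) := by ring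
        _ ≤ c₁ * Real.sqrt (Real.log x) := mul_le_mul_of_nonneg_left h3 hc₁.le
    have h5 : 24 * C₁' * ℓ ^ K ≤ eψ := h1.trans (Real.exp_le_exp.2 h2)
    rw [div_le_iff₀ heψ0]
    have h7 := mul_le_mul_of_nonneg_left h5 (show 0 ≤ ε * x / 8 by positivity)
    have h8 : ε * x / 8 * (24 * C₁' * ℓ ^ K) = 3 * C₁' * x * (ℓ ^ K * ε) := by ring
    rw [h8, hℓKε, mul_one] at h7
    exact h7
  -- the bound `Q` for the brackets
  set Q : ℝ := (2 * Real.log (2 * X) + K₀) / T + 2 * B * P + 2 * B / T ^ 2 with hQdef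
  have hTε : T * (ε ^ 2 / 160) = D₀ := by
    rw [hTdef, show 160 * D₀ * E2 * (ε ^ 2 / 160) = D₀ * (ε ^ 2 * E2) by ring, hεE, mul_one]
  have hQ1 : (2 * Real.log (2 * X) + K₀) / T ≤ ε ^ 2 / 160 := by
    rw [div_le_iff₀ hT0, show ε ^ 2 / 160 * T = T * (ε ^ 2 / 160) by ring, hTε, hD₀def]
    linarith
  have hQ2 : 2 * B / T ^ 2 ≤ ε ^ 2 / 160 := by
    have h1 : 2 * B ≤ T * (ε ^ 2 / 160) * 2 := by rw [hTε]; linarith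
    rw [div_le_iff₀ (by positivity)]
    calc 2 * B ≤ T * (ε ^ 2 / 160) * 2 := h1
      _ ≤ T * (ε ^ 2 / 160) * T := by gcongr
      _ = ε ^ 2 / 160 * T ^ 2 := by ring
  have hQ3 : 2 * B * P ≤ ε ^ 2 / 160 := by linarith
  have hQ : Q ≤ 3 * ε ^ 2 / 160 := by rw [hQdef]; linarith
  have hQ0 : 0 ≤ Q := by rw [hQdef]; positivity
  -- `‖Ix‖ ≤ x² Q`, `‖Iy‖ ≤ 4 x² Q`
  have hlogxX : Real.log x ≤ Real.log (2 * X) := Real.log_le_log hx0 (by linarith)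
  have hlogyX : Real.log y ≤ Real.log (2 * X) := Real.log_le_log hy0 hy2X
  have hPy : y ^ (1 - ℓ ^ (-η) / 2 - 1) ≤ P :=
    Real.rpow_le_rpow_of_nonpos hx0 hxy.le (by linarith)
  set Ix : ℝ := ‖TwistedRieszMean.rieszMeanC (twist χ τ) x -
    delta χ * TwistedRieszMean.mainTerm (1 - τ * I) x‖ with hIxdef
  set Iy : ℝ := ‖TwistedRieszMean.rieszMeanC (twist χ τ) y -
    delta χ * TwistedRieszMean.mainTerm (1 - τ * I) y‖ with hIydef
  have hIx' : Ix ≤ x ^ 2 * Q := by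
    refine hIx.trans (mul_le_mul_of_nonneg_left ?_ (by positivity))
    rw [hQdef]
    gcongr
  have hIy' : Iy ≤ 4 * x ^ 2 * Q := by
    refine hIy.trans ?_
    have h1 : y ^ 2 ≤ 4 * x ^ 2 := by
      have := pow_le_pow_left₀ hy0.le hy2x 2; nlinarith
    have h2 : (2 * Real.log y + K₀) / T + 2 * B * y ^ (1 - ℓ ^ (-η) / 2 - 1) + 2 * B / T ^ 2 ≤ Q := by
      rw [hQdef]; gcongr
    calc y ^ 2 * ((2 * Real.log y + K₀) / T + 2 * B * y ^ (1 - ℓ ^ (-η) / 2 - 1) + 2 * B / T ^ 2)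
        ≤ y ^ 2 * Q := mul_le_mul_of_nonneg_left h2 (by positivity)
      _ ≤ 4 * x ^ 2 * Q := mul_le_mul_of_nonneg_right h1 hQ0
  -- the first term of `hmain`
  have hfirst : (Iy + Ix) / (y - x) ≤ 3 * ε * x / 8 := by
    rw [hyx, div_le_iff₀ hΔx]
    calc Iy + Ix ≤ 4 * x ^ 2 * Q + x ^ 2 * Q := add_le_add hIy' hIx'
      _ = 5 * x ^ 2 * Q := by ring
      _ ≤ 5 * x ^ 2 * (3 * ε ^ 2 / 160) := by gcongr
      _ = 3 * ε * x / 8 * (ε / 4 * x) := by ring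
  -- Chebyshev
  have hψb := psi_sub_psi_le hc₁ hC₁'0 hψ' hx2 hxy.le hy2x
  rw [← heψ] at hψb
  -- assemble
  refine hmain.trans ?_
  generalize Chebyshev.psi y = ψy at hψb ⊢
  generalize Chebyshev.psi x = ψx at hψb ⊢
  have hfin : 3 * ε * x / 8 + Δ * x / 2 + ε * x / 8 + (Δ * x + ε * x / 8) = ε * x := by
    rw [hΔdef]; ring
  linarith [hfirst, hone, hψerr, hψb, hfin, hyx]

end ZetaScale

end Literature.NumberTheory.LFunctions
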